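import Summits.BirchSwinnertonDyer.BirchSwinnertonDyer.Theorems.EisensteinPrimesBSDpOnCellCTelescopeBranchTateFrameRational
import Summits.BirchSwinnertonDyer.BirchSwinnertonDyer.Theorems.EisensteinPrimesBSDpOnCellCTelescopeBranchGaloisLatticeOfUntwistedFact
import Literature.NumberTheory.EllipticCurves.PNewBranchFrobeniusGaloisLattice
import Literature.NumberTheory.EllipticCurves.TateModuleTwistNewformEulerFactorsProofs
import Literature.NumberTheory.EllipticCurves.OrdinaryNewformDatumAttachedProofs
import Literature.NumberTheory.GaloisRepresentations.FramedRepEquivConj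
import Literature.NumberTheory.Transcendental.PadicExpBallProofs
import Literature.NumberTheory.EllipticCurves.CaiShuTian2014.HeegnerConditionProofs
import Literature.NumberTheory.EllipticCurves.TateModuleCayleyHamiltonTorsionProofs
import HarnessLib

/-!
# [telescope — width x2-p2 g24, 2026-08-30] THE v19 BRIDGE: T-An-2ᶠ ⊢ T-An-2ᴴ — Hida 1986 Thm. 2.1 (2.2c) ∘ (2.1b) in FROBENIUS-CHARACTERISTIC-
# POLYNOMIAL currency (ideator g43's `hida1986_castella2020_exists_frobeniusGaloisLattice_on_pNewBranchChart`, module `PNewBranchFrobeniusGaloisLattice`: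
# the reductions of the branch lattice at `X = 0` and at the member points have Frobenius characteristic polynomials `X² − a_ℓ(E)X + ℓ`, resp.
# `X² − ι_t(a_ℓ(g_t))X + ℓ^{k_t−1}`, `ℓ ∤ Np`) IMPLIES the conjugacy-currency fact T-An-2ᴴ (`…_exists_untwistedGaloisLattice_…`, p774987):
# «same Frobenius data ⟹ equivalent over Ω» is PROVED here from tree theorems — Ribet 1977 Thm 2.3 for the members
# (`OrdinaryNewformDatum.isIrreducible_baseChange_padicAlgCl`), Serre/Faltings for `V_pE` of the non-CM curve (cell brick
# `TelescopeBranchTateFrameRational`, ideator g43), Chebotarev + Brauer–Nesbitt/Deligne–Serre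
# (`FramedGaloisRep.nonempty_equiv_of_hasFrobCharpolyAt_of_finite_of_isIrreducible`)
# Crux 4 `BSDpOnCellC` (stmt-BirchSwinnertonDyer-19034), line «telescope» (`--supports`, helper; closes nothing; enables the cadence LEAD's three-line v19)

WHY: LEAD g5's standing rule (13:32:43Z): v19 = `stub_assembledFactsH` ↦ `stub_assembledFactsF : T-An-2ᶠ` with the slot
`carrierAnDistRatGal_of_galoisLattice (galoisLattice_of_untwistedGaloisLattice (untwistedGaloisLattice_of_frobeniusGaloisLattice stub_assembledFactsF))`,
making the registered assumption STRICTLY WEAKER (the «≅ over Ω» upgrade leaves the cited text). THIS FILE is that bridge.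
§1 plumbing; §2 MEMBER: `exists_conj_padicAlgCl_of_frobCharpoly` (equal Frobenius data off the primes of `N` + Ribet ⟹ conjugate over `ℚ̄_p`;
`K_t` finite over `ℚ_p` is DERIVED from (F-rat), `finiteDimensional_padicCoeffField_of_surjective`), `conj_padicComplex_of_padicAlgCl`,
`fibt_untwisted_of_frobenius` (the member specialisation `π ⊗_{evalHom x_t} ℤ_p`, pushed to `Ω = ℂ_p`); §2b ZERO FIBRE:
`fib0_untwisted_of_frobenius` (the reduction `π ⊗_{constantCoeff} ℤ_p` vs the framed `T_pE`, over `A = ℚ_p`, given irreducibility and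
Frobenius data of the framed `T_pE` — supplied by the brick); §3 `untwisted_of_frobenius : IsFrobeniusBranchGaloisLattice W p x D π →
IsUntwistedBranchGaloisLattice W p x D π` (given the brick's inputs) and **`untwistedGaloisLattice_of_frobeniusGaloisLattice : T-An-2ᶠ → T-An-2ᴴ`**
(binder pass-through; basis of `T_pE` from `module_free/finite_tateModule_holds` + `finrank_tateModule_eq_two_…`; `p ∣ N` from multiplicative
reduction).

HONEST FRAMING: an implication between two NAMED FACTS (both `def … : Prop`, D-0014) proved from tree theorems; neither fact is proved; no Galois
lattice is constructed from a modular form; closes no registered stub, no crux, no summit statement; BSD is proved for no curve by this file. No named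
fact declared, no definition, no instance, no `sorry`.
References (shape only): [cite: Hida1986, §2 (2.1b), Thm. 2.1 (2.2b) (2.2c) (p. 557)] [cite: Ribet1977, Thm. 2.3] [cite: DeligneSerreASENS1974, Lemme 3.2]
[cite: SerreAbelianLadic1968, Ch. I §2.3, Ch. IV §2.2]
-/

set_option autoImplicit false
set_option linter.dupNamespace false

noncomputable section

open scoped Classical MatrixGroups ModularForm PowerSeries.WithPiTopology
open PowerSeries IsDedekindDomain NumberField CongruenceSubgroup Field Filter UpperHalfPlane
open Literature.NumberTheory.EllipticCurves Literature.NumberTheory.EllipticCurves.GreenbergSelmer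
  Literature.NumberTheory.EllipticCurves.ModularForms Literature.NumberTheory.GaloisRepresentations Literature.NumberTheory.Transcendental
  Summit.BirchSwinnertonDyer.BirchSwinnertonDyer.Theorems

namespace Summit.BirchSwinnertonDyer.BirchSwinnertonDyer.Theorems.TelescopeBranchUntwistedOfFrobenius

variable {p : ℕ} [Fact p.Prime]

/-! ### §1. Plumbing -/

/-- Unramifiedness passes to any change of coefficients (no injectivity needed). [folklore] -/
theorem isUnramifiedAt_baseChange {A B : Type*} [CommRing A] [TopologicalSpace A] [CommRing B] [TopologicalSpace B]
    (f : A →+* B) (hf : Continuous f) {n : ℕ} {ρ : FramedGaloisRep ℚ A n} {v : HeightOneSpectrum (𝓞 ℚ)}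
    (h : ρ.IsUnramifiedAt v) : FramedGaloisRep.IsUnramifiedAt v (FramedRep.baseChange f hf ρ) := by
  intro 𝔓 h𝔓 σ hσ
  rw [FramedRep.baseChange_apply, h 𝔓 h𝔓 σ hσ, map_one]

/-- If `p ∣ N` and `ℓ ∤ N` then `ℓ ∤ N / p` and `ℓ ≠ p`. [folklore] -/
theorem not_dvd_div_and_ne {N ℓ : ℕ} (hpN : p ∣ N) (hℓ : ¬ ℓ ∣ N) : ¬ ℓ ∣ N / p ∧ ℓ ≠ p := by
  refine ⟨fun h => hℓ (h.trans (Nat.div_dvd_of_dvd hpN)), ?_⟩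
  rintro rfl
  exact hℓ hpN

section Member

variable {M' : ℕ} {k' : ℤ} {g' : CuspForm (CongruenceSubgroup.Gamma0 M') k'} (ι' : coeffField g' →+* PadicAlgCl p)

/-- **(F-rat) ⟹ `K_t` is finite over `ℚ_p`** (indeed `K_t = ℚ_p`): if `ℤ_p → 𝒪_t` is onto then every `x ∈ K_t` is `z / pⁿ` with `z ∈ ℤ_p`. [folklore] -/
theorem finiteDimensional_padicCoeffField_of_surjective (hrat : Function.Surjective (algebraMap ℤ_[p] (padicCoeffIntegers ι'))) :
    FiniteDimensional ℚ_[p] (padicCoeffField ι') := by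
  -- every element of `K_t` lies in the image of `ℚ_p`
  have hsurj : Function.Surjective (algebraMap ℚ_[p] (padicCoeffField ι')) := by
    intro x
    -- `pⁿ x ∈ 𝒪_t` for `n` large
    have hp1 : (1 : ℝ) < p := by exact_mod_cast (Fact.out : p.Prime).one_lt
    obtain ⟨n, hn⟩ : ∃ n : ℕ, ‖((x : padicCoeffField ι') : PadicAlgCl p)‖ ≤ (p : ℝ) ^ n :=
      ⟨⌈Real.logb p ‖((x : padicCoeffField ι') : PadicAlgCl p)‖⌉₊ + 1, by
        by_cases h0 : ‖((x : padicCoeffField ι') : PadicAlgCl p)‖ = 0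
        · rw [h0]; positivity
        · have hpos : 0 < ‖((x : padicCoeffField ι') : PadicAlgCl p)‖ := lt_of_le_of_ne (norm_nonneg _) (Ne.symm h0)
          calc ‖((x : padicCoeffField ι') : PadicAlgCl p)‖
              = (p : ℝ) ^ (Real.logb p ‖((x : padicCoeffField ι') : PadicAlgCl p)‖) := by
                rw [Real.rpow_logb (by positivity) hp1.ne' hpos]
            _ ≤ (p : ℝ) ^ ((⌈Real.logb p ‖((x : padicCoeffField ι') : PadicAlgCl p)‖⌉₊ + 1 : ℕ) : ℝ) := by
                refine Real.rpow_le_rpow_of_exponent_le hp1.le ?_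
                push_cast
                exact (Nat.le_ceil _).trans (by linarith)
            _ = (p : ℝ) ^ (⌈Real.logb p ‖((x : padicCoeffField ι') : PadicAlgCl p)‖⌉₊ + 1) := Real.rpow_natCast _ _⟩
    have hmem : ((p : ℚ_[p]) ^ n • x : padicCoeffField ι') ∈ padicCoeffIntegers ι' := by
      rw [mem_padicCoeffIntegers_iff]
      have h1 : (((p : ℚ_[p]) ^ n • x : padicCoeffField ι') : PadicAlgCl p) = ((p : PadicAlgCl p)) ^ n * ((x : padicCoeffField ι') : PadicAlgCl p) := by
        rw [IntermediateField.coe_smul, Algebra.smul_def, map_pow, map_natCast]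
      rw [h1, norm_mul, norm_pow, PadicExp.norm_natCast_prime (ℓ := p), inv_pow]
      calc ((p : ℝ) ^ n)⁻¹ * ‖((x : padicCoeffField ι') : PadicAlgCl p)‖ ≤ ((p : ℝ) ^ n)⁻¹ * (p : ℝ) ^ n :=
            mul_le_mul_of_nonneg_left hn (by positivity)
        _ = 1 := inv_mul_cancel₀ (by positivity)
    obtain ⟨z, hz⟩ := hrat ⟨_, hmem⟩
    refine ⟨(z : ℚ_[p]) / (p : ℚ_[p]) ^ n, ?_⟩
    have hz' : algebraMap ℚ_[p] (padicCoeffField ι') (z : ℚ_[p]) = (p : ℚ_[p]) ^ n • x := by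
      have h2 := congrArg (fun y : padicCoeffIntegers ι' => (y : padicCoeffField ι')) hz
      simp only at h2
      rw [padicCoeffIntegers.algebraMap_padicInt_eq, padicCoeffIntegers.coe_ofPadicInt] at h2
      exact h2
    have hpn : (p : ℚ_[p]) ^ n ≠ 0 := pow_ne_zero _ (Nat.cast_ne_zero.mpr (Fact.out : p.Prime).ne_zero)
    rw [map_div₀, hz', map_pow, map_natCast, Algebra.smul_def, map_pow, map_natCast]
    exact mul_div_cancel_left₀ _ (pow_ne_zero _ (by exact_mod_cast (Fact.out : p.Prime).ne_zero))
  exact Module.Finite.of_surjective (Algebra.linearMap ℚ_[p] (padicCoeffField ι')) hsurj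

set_option maxHeartbeats 1600000 in
/-- **The member clause: Frobenius currency ⟹ conjugacy over `ℚ̄_p`.** Let `τ : Γ_ℚ →ₜ* GL₂(ℤ_p)` (the specialisation of a branch
lattice at `x_t`), `Δ : OrdinaryNewformDatum g p ι` of a Γ₀-newform `g` of weight `k ≥ 1` with `K_t` finite over `ℚ_p`, and `N` with
`p ∣ N`, `M ∣ ` (here `M` = level of `g`, and every `ℓ ∤ N` satisfies `ℓ ∤ M`, `ℓ ≠ p`). If `τ` is unramified at every `v ∤ N` and every
arithmetic Frobenius there has characteristic polynomial `X² − ι(a_ℓ(g))X + ℓ^{k−1}` (read in `ℚ̄_p[X]`) — Hida's (2.2c) ∘ (2.1b) —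
then `τ` is conjugate OVER `ℚ̄_p` to `Δ.ρ` (Ribet's irreducibility of `Δ.ρ ⊗ ℚ̄_p`, PROVED in the tree, + Deligne–Serre / Brauer–Nesbitt +
Chebotarev, PROVED in the tree: `FramedGaloisRep.nonempty_equiv_of_hasFrobCharpolyAt_of_finite_of_isIrreducible`).
[cite: Hida1986, §2 (2.1b), Thm. 2.1 (2.2c)] [cite: Ribet1977, Thm. 2.3] [cite: DeligneSerreASENS1974, Lemme 3.2] -/
theorem exists_conj_padicAlgCl_of_frobCharpoly [NeZero M'] (Δ : OrdinaryNewformDatum g' p ι') (hg : IsNewform0 g') (hk : 1 ≤ k')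
    [FiniteDimensional ℚ_[p] (padicCoeffField ι')] {N : ℕ} (hN : N ≠ 0) (hMN : M' ∣ N) (hpN : p ∣ N)
    (τ : FramedGaloisRep ℚ ℤ_[p] 2)
    (hunr : ∀ v : HeightOneSpectrum (𝓞 ℚ), ¬ ((Rat.HeightOneSpectrum.primesEquiv v : Nat.Primes) : ℕ) ∣ N → τ.IsUnramifiedAt v)
    (hfrob : ∀ v : HeightOneSpectrum (𝓞 ℚ), ¬ ((Rat.HeightOneSpectrum.primesEquiv v : Nat.Primes) : ℕ) ∣ N →
      ((Rat.HeightOneSpectrum.primesEquiv v : Nat.Primes) : ℕ) ≠ p →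
      ∀ 𝔓 ∈ v.primesAbove, ∀ σ : absoluteGaloisGroup ℚ, IsArithFrobAt (𝓞 ℚ) σ 𝔓 →
        (((τ σ : GL (Fin 2) ℤ_[p]) : Matrix (Fin 2) (Fin 2) ℤ_[p]).charpoly).map ((algebraMap ℚ_[p] (PadicAlgCl p)).comp PadicInt.Coe.ringHom) =
          Polynomial.X ^ 2
            - Polynomial.C (ι' ⟨(qExpansion 1 ⇑g').coeff ((Rat.HeightOneSpectrum.primesEquiv v : Nat.Primes) : ℕ), coeff_mem_coeffField g' _⟩) *
                Polynomial.X
            + Polynomial.C ((((Rat.HeightOneSpectrum.primesEquiv v : Nat.Primes) : ℕ) : PadicAlgCl p) ^ (k' - 1).toNat)) :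
    ∃ P : GL (Fin 2) (PadicAlgCl p), ∀ σ : absoluteGaloisGroup ℚ,
      (((τ σ : GL (Fin 2) ℤ_[p]) : Matrix (Fin 2) (Fin 2) ℤ_[p]).map ((algebraMap ℚ_[p] (PadicAlgCl p)).comp PadicInt.Coe.ringHom)) =
        ((P : GL (Fin 2) (PadicAlgCl p)) : Matrix (Fin 2) (Fin 2) (PadicAlgCl p)) *
          (((Δ.ρ σ : GL (Fin 2) (padicCoeffIntegers ι')) : Matrix (Fin 2) (Fin 2) (padicCoeffIntegers ι')).map
            (padicCoeffIntegers.toPadicAlgCl ι')) *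
          ((P⁻¹ : GL (Fin 2) (PadicAlgCl p)) : Matrix (Fin 2) (Fin 2) (PadicAlgCl p)) := by
  -- the two representations over `ℚ̄_p`
  set f : ℤ_[p] →+* PadicAlgCl p := (algebraMap ℚ_[p] (PadicAlgCl p)).comp PadicInt.Coe.ringHom with hf
  have hfc : Continuous f := (continuous_algebraMap ℚ_[p] (PadicAlgCl p)).comp continuous_subtype_val
  set r : FramedGaloisRep ℚ (PadicAlgCl p) 2 := FramedRep.baseChange (padicCoeffIntegers.toPadicAlgCl ι') continuous_toPadicAlgCl Δ.ρ with hr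
  set r' : FramedGaloisRep ℚ (PadicAlgCl p) 2 := FramedRep.baseChange f hfc τ with hr'
  have hirr : r.toGaloisRep.IsIrreducible := Δ.isIrreducible_baseChange_padicAlgCl hg hk
  -- Frobenius data off the primes of `N`
  have hST : ∀ v ∉ {v : HeightOneSpectrum (𝓞 ℚ) | ((Rat.HeightOneSpectrum.primesEquiv v : Nat.Primes) : ℕ) ∣ N},
      r.IsUnramifiedAt v ∧ r'.IsUnramifiedAt v ∧ ∃ P : Polynomial (PadicAlgCl p), r.HasFrobCharpolyAt v P ∧ r'.HasFrobCharpolyAt v P := by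
    intro v hv
    rw [Set.mem_setOf_eq] at hv
    obtain ⟨hℓM, hℓp⟩ := not_dvd_div_and_ne (p := p) hpN hv
    have hℓM' : ¬ ((Rat.HeightOneSpectrum.primesEquiv v : Nat.Primes) : ℕ) ∣ M' := fun h => hv (h.trans hMN)
    obtain ⟨hΔunr, P₀, hP₀, hΔP₀⟩ := Δ.charpoly v hℓM' hℓp
    refine ⟨isUnramifiedAt_baseChange _ _ hΔunr, isUnramifiedAt_baseChange _ _ (hunr v hv), P₀.map (padicCoeffIntegers.toPadicAlgCl ι'),
      FramedGaloisRep.hasFrobCharpolyAt_baseChange _ _ hΔP₀, ?_⟩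
    intro 𝔓 h𝔓 σ hσ
    rw [FramedRep.charpoly_baseChange, hP₀]
    exact hfrob v hv hℓp 𝔓 h𝔓 σ hσ
  have hfin : {v : HeightOneSpectrum (𝓞 ℚ) | ((Rat.HeightOneSpectrum.primesEquiv v : Nat.Primes) : ℕ) ∣ N}.Finite := by
    have h1 : ({m : ℕ | m ∣ N} : Set ℕ).Finite := (Set.finite_le_nat N).subset fun m hm => Nat.le_of_dvd (Nat.pos_of_ne_zero hN) hm
    have h2 : ((Subtype.val : Nat.Primes → ℕ) ⁻¹' {m : ℕ | m ∣ N}).Finite := Set.Finite.preimage (Subtype.val_injective.injOn) h1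
    have h3 : ((fun v : HeightOneSpectrum (𝓞 ℚ) => (Rat.HeightOneSpectrum.primesEquiv v : Nat.Primes)) ⁻¹'
        ((Subtype.val : Nat.Primes → ℕ) ⁻¹' {m : ℕ | m ∣ N})).Finite := Set.Finite.preimage (Rat.HeightOneSpectrum.primesEquiv.injective.injOn) h2
    exact h3
  obtain ⟨e⟩ := FramedGaloisRep.nonempty_equiv_of_hasFrobCharpolyAt_of_finite_of_isIrreducible hfin r r' hirr hST
  obtain ⟨P, hP⟩ := FramedRep.exists_eq_conj_of_equiv r r' e
  refine ⟨P, fun σ => ?_⟩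
  have h1 : r' σ = P * r σ * P⁻¹ := by rw [hP, FramedRep.conj_apply]
  have h2 := congrArg (fun u : GL (Fin 2) (PadicAlgCl p) => (u : Matrix (Fin 2) (Fin 2) (PadicAlgCl p))) h1
  simp only [Units.val_mul, hr, hr', FramedRep.coe_baseChange_apply] at h2
  exact h2

/-- **Push a conjugacy over `ℚ̄_p` to `ℂ_p`** (T-An-2ᴴ reads its fibres over `Ω = ℂ_p`): for matrices `M ∈ M₂(ℤ_p)`, `B ∈ M₂(𝒪_t)` and
`P ∈ GL₂(ℚ̄_p)` with `M^{ℚ̄_p} = P · B^{ℚ̄_p} · P⁻¹`, the images in `ℂ_p` satisfy the same relation with `P` mapped to `GL₂(ℂ_p)`. [folklore] -/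
theorem conj_padicComplex_of_padicAlgCl (M : Matrix (Fin 2) (Fin 2) ℤ_[p]) (B : Matrix (Fin 2) (Fin 2) (padicCoeffIntegers ι'))
    (P : GL (Fin 2) (PadicAlgCl p))
    (h : M.map ((algebraMap ℚ_[p] (PadicAlgCl p)).comp PadicInt.Coe.ringHom) =
      ((P : GL (Fin 2) (PadicAlgCl p)) : Matrix (Fin 2) (Fin 2) (PadicAlgCl p)) * B.map (padicCoeffIntegers.toPadicAlgCl ι') *
        ((P⁻¹ : GL (Fin 2) (PadicAlgCl p)) : Matrix (Fin 2) (Fin 2) (PadicAlgCl p))) :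
    M.map (fun z : ℤ_[p] => algebraMap ℚ_[p] ℂ_[p] (z : ℚ_[p])) =
      (((Matrix.GeneralLinearGroup.map (algebraMap (PadicAlgCl p) ℂ_[p]) P : GL (Fin 2) ℂ_[p])) : Matrix (Fin 2) (Fin 2) ℂ_[p]) *
        B.map (fun z : padicCoeffIntegers ι' => algebraMap (padicCoeffField ι') ℂ_[p] (z : padicCoeffField ι')) *
        ((((Matrix.GeneralLinearGroup.map (algebraMap (PadicAlgCl p) ℂ_[p]) P)⁻¹ : GL (Fin 2) ℂ_[p])) : Matrix (Fin 2) (Fin 2) ℂ_[p]) := by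
  have h1 := congrArg (fun A : Matrix (Fin 2) (Fin 2) (PadicAlgCl p) => A.map (algebraMap (PadicAlgCl p) ℂ_[p])) h
  simp only [Matrix.map_mul, Matrix.map_map] at h1
  have hM : ((algebraMap (PadicAlgCl p) ℂ_[p]) ∘ ((algebraMap ℚ_[p] (PadicAlgCl p)).comp PadicInt.Coe.ringHom)) =
      fun z : ℤ_[p] => algebraMap ℚ_[p] ℂ_[p] (z : ℚ_[p]) := by
    funext z
    simp only [Function.comp_apply, RingHom.coe_comp]
    rw [← IsScalarTower.algebraMap_apply]
    rfl
  have hB : ((algebraMap (PadicAlgCl p) ℂ_[p]) ∘ (padicCoeffIntegers.toPadicAlgCl ι')) =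
      fun z : padicCoeffIntegers ι' => algebraMap (padicCoeffField ι') ℂ_[p] (z : padicCoeffField ι') := by
    funext z
    simp only [Function.comp_apply, padicCoeffIntegers.toPadicAlgCl_apply]
    rw [IsScalarTower.algebraMap_apply (padicCoeffField ι') (PadicAlgCl p) ℂ_[p]]
    rfl
  rw [hM, hB] at h1
  rw [h1, ← map_inv]
  rfl

/-- **The member clause of T-An-2ᴴ from the member clause of T-An-2ᶠ′**, for the specialisation `π mod (X − x_t)` of a framed
`π : Γ_ℚ →ₜ* GL₂(ℤ_p⟦X⟧)` at a member point (`τ := π ⊗_{evalHom x_t} ℤ_p`), read over `Ω = ℂ_p`.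
[cite: Hida1986, §2 (2.1b), Thm. 2.1 (2.2c)] [cite: Ribet1977, Thm. 2.3] -/
theorem fibt_untwisted_of_frobenius [NeZero M'] (Δ : OrdinaryNewformDatum g' p ι') (hg : IsNewform0 g') (hk : 1 ≤ k')
    (hrat : Function.Surjective (algebraMap ℤ_[p] (padicCoeffIntegers ι')))
    {N : ℕ} (hN : N ≠ 0) (hMN : M' ∣ N) (hpN : p ∣ N)
    (π : FramedGaloisRep ℚ (PowerSeries ℤ_[p]) 2)
    (hunr : ∀ v : HeightOneSpectrum (𝓞 ℚ), ¬ ((Rat.HeightOneSpectrum.primesEquiv v : Nat.Primes) : ℕ) ∣ N → π.IsUnramifiedAt v)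
    {xt : ℤ_[p]} (ht : ‖xt‖ < 1)
    (hfrob : ∀ v : HeightOneSpectrum (𝓞 ℚ), ¬ ((Rat.HeightOneSpectrum.primesEquiv v : Nat.Primes) : ℕ) ∣ N →
      ((Rat.HeightOneSpectrum.primesEquiv v : Nat.Primes) : ℕ) ≠ p →
      ∀ 𝔓 ∈ v.primesAbove, ∀ σ : absoluteGaloisGroup ℚ, IsArithFrobAt (𝓞 ℚ) σ 𝔓 →
        ((((π σ : GL (Fin 2) (PowerSeries ℤ_[p])) : Matrix (Fin 2) (Fin 2) (PowerSeries ℤ_[p])).map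
            (evalHom xt ht)).charpoly).map ((algebraMap ℚ_[p] (PadicAlgCl p)).comp PadicInt.Coe.ringHom) =
          Polynomial.X ^ 2
            - Polynomial.C (ι' ⟨(qExpansion 1 ⇑g').coeff ((Rat.HeightOneSpectrum.primesEquiv v : Nat.Primes) : ℕ), coeff_mem_coeffField g' _⟩) *
                Polynomial.X
            + Polynomial.C ((((Rat.HeightOneSpectrum.primesEquiv v : Nat.Primes) : ℕ) : PadicAlgCl p) ^ (k' - 1).toNat)) :
    ∃ P : GL (Fin 2) ℂ_[p], ∀ σ : absoluteGaloisGroup ℚ,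
      ((((π σ : GL (Fin 2) (PowerSeries ℤ_[p])) : Matrix (Fin 2) (Fin 2) (PowerSeries ℤ_[p])).map (evalHom xt ht)).map
          (fun z : ℤ_[p] => algebraMap ℚ_[p] ℂ_[p] (z : ℚ_[p]))) =
        ((P : GL (Fin 2) ℂ_[p]) : Matrix (Fin 2) (Fin 2) ℂ_[p]) *
          (((Δ.ρ σ : GL (Fin 2) (padicCoeffIntegers ι')) : Matrix (Fin 2) (Fin 2) (padicCoeffIntegers ι')).map
            (fun z : padicCoeffIntegers ι' => algebraMap (padicCoeffField ι') ℂ_[p] (z : padicCoeffField ι'))) *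
          ((P⁻¹ : GL (Fin 2) ℂ_[p]) : Matrix (Fin 2) (Fin 2) ℂ_[p]) := by
  haveI : FiniteDimensional ℚ_[p] (padicCoeffField ι') := finiteDimensional_padicCoeffField_of_surjective ι' hrat
  -- the specialisation as a framed representation over `ℤ_p`
  have hcont : Continuous (evalHom xt ht) := by
    rw [show ((evalHom xt ht : ℤ_[p]⟦X⟧ →+* ℤ_[p]) : ℤ_[p]⟦X⟧ → ℤ_[p]) = PowerSeries.eval₂ (RingHom.id ℤ_[p]) xt from
      funext fun G => evalHom_apply xt ht G]
    exact PowerSeries.continuous_eval₂ (φ := RingHom.id ℤ_[p]) continuous_id (padicInt_hasEval ht)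
  set τ : FramedGaloisRep ℚ ℤ_[p] 2 := FramedRep.baseChange (evalHom xt ht) hcont π with hτ
  have hτσ : ∀ σ, ((τ σ : GL (Fin 2) ℤ_[p]) : Matrix (Fin 2) (Fin 2) ℤ_[p]) =
      (((π σ : GL (Fin 2) (PowerSeries ℤ_[p])) : Matrix (Fin 2) (Fin 2) (PowerSeries ℤ_[p])).map (evalHom xt ht)) :=
    fun σ => FramedRep.coe_baseChange_apply _ hcont π σ
  obtain ⟨P, hP⟩ := exists_conj_padicAlgCl_of_frobCharpoly ι' Δ hg hk hN hMN hpN τ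
    (fun v hv => isUnramifiedAt_baseChange _ hcont (hunr v hv))
    (fun v hv hp' 𝔓 h𝔓 σ hσ => by rw [hτσ]; exact hfrob v hv hp' 𝔓 h𝔓 σ hσ)
  refine ⟨Matrix.GeneralLinearGroup.map (algebraMap (PadicAlgCl p) ℂ_[p]) P, fun σ => ?_⟩
  rw [← hτσ]
  exact conj_padicComplex_of_padicAlgCl ι' _ _ P (hP σ)

end Member

/-! ### §2b. The zero fibre from Frobenius data (irreducibility of the framed `T_pE ⊗ ℚ_p` as INPUT) -/

section ZeroFibre

variable (W : WeierstrassCurve ℚ) [W.IsGloballyMinimal]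

set_option maxHeartbeats 1600000 in
/-- **The weight-two clause: Frobenius currency ⟹ conjugacy over `ℂ_p`.** Let `b` be a `ℤ_p`-basis of `T_pE`, `T := [T_pE]_b`
(the tree's continuous Tate-module representation framed in `b`) with `T ⊗ ℚ_p` IRREDUCIBLE (input `hirr`; for `E` without CM this is
Serre/Faltings, supplied by the cell's brick `…TateFrameRational`), unramified with Frobenius characteristic polynomial
`X² − a_ℓ(E)X + ℓ` at every `ℓ ∤ N` (input `hT`; Silverman C.21 / the tree's `trace/det_galoisRepTate_frobenius_…`), `p ∣ N ≠ 0`.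
If `π : Γ_ℚ →ₜ* GL₂(ℤ_p⟦X⟧)` is unramified at `v ∤ N` and its `X = 0` fibre has the same Frobenius characteristic polynomials
(T-An-2ᶠ's (F-fib₀), verbatim), then the `X = 0` fibre is conjugate OVER `ℂ_p` to `[T_pE]_b` — T-An-2ᴴ's (U-fib₀).
[cite: Hida1986, Thm. 2.1 (2.2c), §2 (2.1b)] [cite: DeligneSerreASENS1974, Lemme 3.2] [cite: SilvermanAEC2009, C.21 Remark 21.3] -/
theorem fib0_untwisted_of_frobenius [Module.Finite ℤ_[p] (W.tateModule p)] [IsModuleTopology ℤ_[p] (W.tateModule p)]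
    (b : Module.Basis (Fin 2) ℤ_[p] (W.tateModule p))
    (hirr : (FramedGaloisRep.toGaloisRep (FramedRep.baseChange (PadicInt.Coe.ringHom (p := p)) continuous_subtype_val
      ((WeierstrassCurve.tateGaloisRep W p (W.continuous_galoisRepTate_holds p)).frame b))).IsIrreducible)
    {N : ℕ} (hN : N ≠ 0) (hpN : p ∣ N)
    (hT : ∀ v : HeightOneSpectrum (𝓞 ℚ), ¬ ((Rat.HeightOneSpectrum.primesEquiv v : Nat.Primes) : ℕ) ∣ N →
      FramedGaloisRep.IsUnramifiedAt v ((WeierstrassCurve.tateGaloisRep W p (W.continuous_galoisRepTate_holds p)).frame b) ∧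
      FramedGaloisRep.HasFrobCharpolyAt v
        (Polynomial.X ^ 2
          - Polynomial.C (((W.frobeniusTrace ((Rat.HeightOneSpectrum.primesEquiv v : Nat.Primes) : ℕ) : ℤ) : ℤ_[p])) * Polynomial.X
          + Polynomial.C ((((Rat.HeightOneSpectrum.primesEquiv v : Nat.Primes) : ℕ) : ℤ_[p])))
        ((WeierstrassCurve.tateGaloisRep W p (W.continuous_galoisRepTate_holds p)).frame b))
    (π : FramedGaloisRep ℚ (PowerSeries ℤ_[p]) 2)
    (hunr : ∀ v : HeightOneSpectrum (𝓞 ℚ), ¬ ((Rat.HeightOneSpectrum.primesEquiv v : Nat.Primes) : ℕ) ∣ N → π.IsUnramifiedAt v)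
    (hfib0 : ∀ v : HeightOneSpectrum (𝓞 ℚ), ¬ ((Rat.HeightOneSpectrum.primesEquiv v : Nat.Primes) : ℕ) ∣ N →
      ((Rat.HeightOneSpectrum.primesEquiv v : Nat.Primes) : ℕ) ≠ p →
      ∀ 𝔓 ∈ v.primesAbove, ∀ σ : absoluteGaloisGroup ℚ, IsArithFrobAt (𝓞 ℚ) σ 𝔓 →
        ((((π σ : GL (Fin 2) (PowerSeries ℤ_[p])) : Matrix (Fin 2) (Fin 2) (PowerSeries ℤ_[p])).map
            (fun F : PowerSeries ℤ_[p] => (PowerSeries.constantCoeff F : ℤ_[p]))).charpoly =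
          Polynomial.X ^ 2
            - Polynomial.C (((W.frobeniusTrace ((Rat.HeightOneSpectrum.primesEquiv v : Nat.Primes) : ℕ) : ℤ) : ℤ_[p])) * Polynomial.X
            + Polynomial.C ((((Rat.HeightOneSpectrum.primesEquiv v : Nat.Primes) : ℕ) : ℤ_[p])))) :
    ∃ P : GL (Fin 2) ℂ_[p], ∀ σ : absoluteGaloisGroup ℚ,
      (((π σ : GL (Fin 2) (PowerSeries ℤ_[p])) : Matrix (Fin 2) (Fin 2) (PowerSeries ℤ_[p])).map
          (fun F : PowerSeries ℤ_[p] => algebraMap ℚ_[p] ℂ_[p] ((PowerSeries.constantCoeff F : ℤ_[p]) : ℚ_[p]))) =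
        ((P : GL (Fin 2) ℂ_[p]) : Matrix (Fin 2) (Fin 2) ℂ_[p]) *
          (LinearMap.toMatrix b b (W.galoisRepTate p σ)).map (fun z : ℤ_[p] => algebraMap ℚ_[p] ℂ_[p] (z : ℚ_[p])) *
          ((P⁻¹ : GL (Fin 2) ℂ_[p]) : Matrix (Fin 2) (Fin 2) ℂ_[p]) := by
  -- the `X = 0` fibre as a framed representation over `ℤ_p`, and both sides over `ℚ_p`
  set c : PowerSeries ℤ_[p] →+* ℤ_[p] := PowerSeries.constantCoeff (R := ℤ_[p]) with hc
  have hcc : Continuous c := PowerSeries.WithPiTopology.continuous_constantCoeff ℤ_[p]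
  set τ : FramedGaloisRep ℚ ℤ_[p] 2 := FramedRep.baseChange c hcc π with hτ
  set T : FramedGaloisRep ℚ ℤ_[p] 2 := (WeierstrassCurve.tateGaloisRep W p (W.continuous_galoisRepTate_holds p)).frame b with hTdef
  set q : ℤ_[p] →+* ℚ_[p] := PadicInt.Coe.ringHom with hq
  have hqc : Continuous q := continuous_subtype_val
  set r : FramedGaloisRep ℚ ℚ_[p] 2 := FramedRep.baseChange q hqc T with hr
  set r' : FramedGaloisRep ℚ ℚ_[p] 2 := FramedRep.baseChange q hqc τ with hr'
  have hST : ∀ v ∉ {v : HeightOneSpectrum (𝓞 ℚ) | ((Rat.HeightOneSpectrum.primesEquiv v : Nat.Primes) : ℕ) ∣ N},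
      r.IsUnramifiedAt v ∧ r'.IsUnramifiedAt v ∧ ∃ P : Polynomial ℚ_[p], r.HasFrobCharpolyAt v P ∧ r'.HasFrobCharpolyAt v P := by
    intro v hv
    rw [Set.mem_setOf_eq] at hv
    have hℓp : ((Rat.HeightOneSpectrum.primesEquiv v : Nat.Primes) : ℕ) ≠ p := (not_dvd_div_and_ne (p := p) hpN hv).2
    obtain ⟨hTunr, hTP⟩ := hT v hv
    refine ⟨isUnramifiedAt_baseChange _ _ hTunr, isUnramifiedAt_baseChange _ _ (isUnramifiedAt_baseChange _ _ (hunr v hv)), _,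
      FramedGaloisRep.hasFrobCharpolyAt_baseChange _ _ hTP, ?_⟩
    intro 𝔓 h𝔓 σ hσ
    rw [FramedRep.charpoly_baseChange]
    congr 1
    have h1 : ((τ σ : GL (Fin 2) ℤ_[p]) : Matrix (Fin 2) (Fin 2) ℤ_[p]) =
        (((π σ : GL (Fin 2) (PowerSeries ℤ_[p])) : Matrix (Fin 2) (Fin 2) (PowerSeries ℤ_[p])).map
          (fun F : PowerSeries ℤ_[p] => (PowerSeries.constantCoeff F : ℤ_[p]))) := FramedRep.coe_baseChange_apply c hcc π σ
    change ((τ σ : GL (Fin 2) ℤ_[p]) : Matrix (Fin 2) (Fin 2) ℤ_[p]).charpoly = _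
    rw [h1]
    exact hfib0 v hv hℓp 𝔓 h𝔓 σ hσ
  have hfin : {v : HeightOneSpectrum (𝓞 ℚ) | ((Rat.HeightOneSpectrum.primesEquiv v : Nat.Primes) : ℕ) ∣ N}.Finite := by
    have h1 : ({m : ℕ | m ∣ N} : Set ℕ).Finite := (Set.finite_le_nat N).subset fun m hm => Nat.le_of_dvd (Nat.pos_of_ne_zero hN) hm
    have h2 : ((Subtype.val : Nat.Primes → ℕ) ⁻¹' {m : ℕ | m ∣ N}).Finite := Set.Finite.preimage (Subtype.val_injective.injOn) h1
    have h3 : ((fun v : HeightOneSpectrum (𝓞 ℚ) => (Rat.HeightOneSpectrum.primesEquiv v : Nat.Primes)) ⁻¹'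
        ((Subtype.val : Nat.Primes → ℕ) ⁻¹' {m : ℕ | m ∣ N})).Finite := Set.Finite.preimage (Rat.HeightOneSpectrum.primesEquiv.injective.injOn) h2
    exact h3
  obtain ⟨e⟩ := FramedGaloisRep.nonempty_equiv_of_hasFrobCharpolyAt_of_finite_of_isIrreducible hfin r r' hirr hST
  obtain ⟨P, hP⟩ := FramedRep.exists_eq_conj_of_equiv r r' e
  refine ⟨Matrix.GeneralLinearGroup.map (algebraMap ℚ_[p] ℂ_[p]) P, fun σ => ?_⟩
  have h1 : r' σ = P * r σ * P⁻¹ := by rw [hP, FramedRep.conj_apply]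
  have h2 := congrArg (fun u : GL (Fin 2) ℚ_[p] => ((u : Matrix (Fin 2) (Fin 2) ℚ_[p])).map (algebraMap ℚ_[p] ℂ_[p])) h1
  simp only [Units.val_mul, hr, hr', hτ, hTdef, FramedRep.coe_baseChange_apply, Matrix.map_mul, Matrix.map_map] at h2
  rw [ContinuousRep.coe_frame_apply] at h2
  rw [← map_inv]
  exact h2

end ZeroFibre

/-! ### §3. The bridges: predicate level and fact level -/

/-- `N_E ≠ 0` and `p ∣ N_E` give `N_E / p ≠ 0`. [folklore] -/
theorem conductorNorm_div_ne_zero (W : WeierstrassCurve ℚ) (hN : W.conductorNorm ℤ ≠ 0) (hpN : p ∣ W.conductorNorm ℤ) :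
    W.conductorNorm ℤ / p ≠ 0 :=
  (Nat.div_pos (Nat.le_of_dvd (Nat.pos_of_ne_zero hN) hpN) (Fact.out : p.Prime).pos).ne'

set_option maxHeartbeats 1600000 in
/-- **T-An-2ᶠ's Galois clause ⟹ T-An-2ᴴ's Galois clause (FULL Frobenius currency, zero fibre included)**, GIVEN a `ℤ_p`-basis `b` of `T_pE`
with the framed `T_pE ⊗ ℚ_p` irreducible (`hirr`) and its Frobenius data at `ℓ ∤ N` (`hT`) — the two inputs the cell's Tate-frame brick supplies
for a curve without CM (multiplicative at `p`). [cite: Hida1986, Thm. 2.1 (2.2b) (2.2c), §2 (2.1b)] [cite: Ribet1977, Thm. 2.3] -/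
theorem untwisted_of_frobenius (W : WeierstrassCurve ℚ) [W.IsElliptic] [W.IsGloballyMinimal]
    [Module.Finite ℤ_[p] (W.tateModule p)] [IsModuleTopology ℤ_[p] (W.tateModule p)]
    (hN : W.conductorNorm ℤ ≠ 0) (hpN : p ∣ W.conductorNorm ℤ) (b : Module.Basis (Fin 2) ℤ_[p] (W.tateModule p))
    (hirr : (FramedGaloisRep.toGaloisRep (FramedRep.baseChange (PadicInt.Coe.ringHom (p := p)) continuous_subtype_val
      ((WeierstrassCurve.tateGaloisRep W p (W.continuous_galoisRepTate_holds p)).frame b))).IsIrreducible)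
    (hT : ∀ v : HeightOneSpectrum (𝓞 ℚ), ¬ ((Rat.HeightOneSpectrum.primesEquiv v : Nat.Primes) : ℕ) ∣ W.conductorNorm ℤ →
      FramedGaloisRep.IsUnramifiedAt v ((WeierstrassCurve.tateGaloisRep W p (W.continuous_galoisRepTate_holds p)).frame b) ∧
      FramedGaloisRep.HasFrobCharpolyAt v
        (Polynomial.X ^ 2
          - Polynomial.C (((W.frobeniusTrace ((Rat.HeightOneSpectrum.primesEquiv v : Nat.Primes) : ℕ) : ℤ) : ℤ_[p])) * Polynomial.X
          + Polynomial.C ((((Rat.HeightOneSpectrum.primesEquiv v : Nat.Primes) : ℕ) : ℤ_[p])))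
        ((WeierstrassCurve.tateGaloisRep W p (W.continuous_galoisRepTate_holds p)).frame b))
    (x : ℕ → ℤ_[p]) (D : ℕ → Skinner2016.HidaCongruentForm W p 1)
    (π : FramedGaloisRep ℚ (PowerSeries ℤ_[p]) 2) (h : IsFrobeniusBranchGaloisLattice W p x D π) :
    IsUntwistedBranchGaloisLattice W p x D π := by
  haveI : NeZero (W.conductorNorm ℤ / p) := ⟨conductorNorm_div_ne_zero W hN hpN⟩
  refine ⟨h.1, ⟨b, fib0_untwisted_of_frobenius W b hirr hN hpN hT π h.1 h.2.1⟩, fun t ht => ?_, h.2.2.2⟩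
  have hk : 1 ≤ (D t).k := by linarith [(D t).two_lt_k]
  exact fibt_untwisted_of_frobenius (D t).ι (D t).Δ (D t).isNewform hk (h.2.2.2 t) hN (Nat.div_dvd_of_dvd hpN) hpN π h.1 ht
    (h.2.2.1 t ht)

set_option maxHeartbeats 800000 in
/-- **T-An-2ᶠ ⊢ T-An-2ᴴ** (fact level, FULL Frobenius currency): binders and analytic conjuncts pass through; the Galois clause by
`untwisted_of_frobenius` with the cell's Tate-frame brick (`TelescopeBranchTateFrameRational`: a `ℤ_p`-basis of `T_pE`, irreducibility of
`T_pE ⊗ ℚ_p` for the non-CM curve — multiplicative at `p` — and its Frobenius data at `ℓ ∤ N`). [cite: Hida1986, Thm. 2.1 (2.2b) (2.2c), §2 (2.1b)]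
[cite: Ribet1977, Thm. 2.3] [cite: SerreAbelianLadic1968, Ch. IV §2.2] -/
theorem untwistedGaloisLattice_of_frobeniusGaloisLattice (h : hida1986_castella2020_exists_frobeniusGaloisLattice_on_pNewBranchChart) :
    hida1986_castella2020_exists_untwistedGaloisLattice_on_pNewBranchChart := by
  intro p _ ι W _ _ K _ _ 𝔭 κ γ _ N _ f hf hN hp hmult hK hodd hdisc hHeeg hsplit h𝔭 hι hκ j hj
  obtain ⟨A, x, D, hchart, han, π, hF⟩ := h ι W K 𝔭 κ γ hf hN hp hmult hK hodd hdisc hHeeg hsplit h𝔭 hι hκ j hj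
  have hN0 : W.conductorNorm ℤ ≠ 0 := by rw [hN]; exact NeZero.ne N
  have hpN : p ∣ W.conductorNorm ℤ := TelescopeBranchGaloisLatticeOfUntwistedFact.dvd_conductorNorm_of_hasMultiplicativeReductionAtPrime W p hmult
  -- a `ℤ_p`-basis of `T_pE` (free of rank two) and the module topology
  haveI : Module.Free ℤ_[p] (W.tateModule p) := WeierstrassCurve.module_free_tateModule_holds W p
  haveI : Module.Finite ℤ_[p] (W.tateModule p) := WeierstrassCurve.module_finite_tateModule_holds W p
  have hpQ : (p : ℚ) ≠ 0 := Nat.cast_ne_zero.mpr (Fact.out : p.Prime).ne_zero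
  have hrank : Module.finrank ℤ_[p] (W.tateModule p) = 2 :=
    WeierstrassCurve.finrank_tateModule_eq_two_of_card_torsionPoints_eq_sq W p (WeierstrassCurve.card_torsionPoints_eq_sq_holds W _) hpQ
  let b : Module.Basis (Fin 2) ℤ_[p] (W.tateModule p) := Module.finBasisOfFinrankEq ℤ_[p] (W.tateModule p) hrank
  haveI : IsModuleTopology ℤ_[p] (W.tateModule p) := TateModule.isModuleTopology
  exact ⟨A, x, D, hchart, han, π, untwisted_of_frobenius W hN0 hpN b
    (TelescopeBranchTateFrameRational.isIrreducible_toGaloisRep_baseChange_tateFrame_of_hasMultiplicativeReductionAtPrime W hmult b)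
    (fun v hv => TelescopeBranchTateFrameRational.isUnramifiedAt_and_hasFrobCharpolyAt_tateFrame W hpN b v hv) x D π hF⟩

end Summit.BirchSwinnertonDyer.BirchSwinnertonDyer.Theorems.TelescopeBranchUntwistedOfFrobenius

end
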